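import Literature.Analysis.Complex.JensenPolynomialHyperbolicity
import Mathlib.Algebra.Order.BigOperators.Ring.Finset
import Mathlib.Algebra.Order.Chebyshev
import Mathlib.Data.Complex.BigOperators
import HarnessLib

/-!
# Obreschkoff's sector generalisation of the Hermite–Poulain theorem (proved)

Trunk `Literature/Analysis/Complex`, grouping namespace `Literature.Analysis.Complex.Obreschkoff`.

**Theorem (Obreschkoff 1961/64; as printed in Kim–Lee 2021, Theorem 3).** "Suppose that `P` and `Q`
are real polynomials, `δ > 0`, `Z(P) ⊂ S(δ)`, `Q` is hyperbolic and `deg Q ≤ δ⁻²`. Then the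
polynomial `P(D)Q = Σ_{k ≤ deg P} P⁽ᵏ⁾(0)/k! · Q⁽ᵏ⁾` is hyperbolic." Here
`S(δ) = {z ∈ ℂ : |Im z| ≤ δ |z|}` (the double sector of half-opening `arcsin δ` around the real
axis), "hyperbolic" = all zeros real = `Polynomial.Splits` over `ℝ` (the tree's convention, GORZ 2019
§1; the zero polynomial counts as hyperbolic), and `Z(P)` is the complex zero set of `P`.
**Corollary (Kim–Lee 2021, Corollary to Thm. 3).** "Suppose that `P` is a real polynomial, `δ > 0`
and `Z(P) ⊂ S(δ)`. Then `J(P; d)` is hyperbolic for `d ≤ δ⁻²`", `J(P; d) = Σ_k (d choose k) P⁽ᵏ⁾(0) zᵏ`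
being the Jensen polynomial (`Q = z^d`, `J(P;d)(z) = z^d (P(D)Q)(1/z)`).

This is the polynomial heart of Chasse's theorem (Chasse 2013, Thm. 1.8; Farmer 2022, §4: "if all
the zeros of the zeta-function are on the critical line for `|γ| < T`, then `J^{d,0}` has only real
zeros for `d < T²`"), used in `Literature/Barriers/RiemannHypothesis/JensenPolynomialsChasse.lean`.

## The proof given here (all proved; Obreschkoff's paper was not available to us)

Induction on the factorisation of `P` over `ℝ` into a constant, linear factors `X - a` (real zeros)
and quadratic factors `(X - b)² + c²` (conjugate pairs `b ± ic ∈ S(δ)`; Mathlib's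
`Polynomial.quadratic_dvd_of_aeval_eq_zero_im_ne_zero`), applying the factors of
`P(D)` one at a time to `Q` (they commute and none raises the degree):
* `(D - a) Q = Q' - aQ` is hyperbolic when `Q` is — the Hermite–Poulain step, the tree's
  `Literature.Analysis.Complex.PolyaSchur.splits_derivative_sub_C_mul`;
* **key lemma** (`splits_quadOp`): if `Q` is hyperbolic of degree `n` and `(n - 1) c² ≤ b²`, then
  `((D - b)² + c²) Q = Q'' - 2b Q' + (b² + c²) Q` is hyperbolic. (For `b + ic ∈ S(δ)` and
  `n ≤ δ⁻²`: `c² ≤ δ²(b² + c²) ≤ (b² + c²)/n`, i.e. `(n-1)c² ≤ b²`.) The condition is sharp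
  (`Q = Xⁿ`). Proof: at a zero `z ∉ ℝ` of `((D-b)²+c²)Q`, with `w_j = 1/(z - r_j) = u_j - i v_j`
  over the roots `r_j` of `Q` (all `v_j` of the sign of `Im z`), `F = Σ w_j = Q'/Q(z)` and
  `Q''/Q(z) = F² - Σ w_j²`, the equation `F² - Σw_j² - 2bF + b² + c² = 0` gives
  `b V = U V - A` and `c² = Σu_j² - (U-b)² + V² - Σv_j²` (`U = Σu_j`, `V = Σv_j`, `A = Σ u_j v_j`),
  whence `n V² ((n-1)c² - b²) = (n-1)V²(nΣu² - U²) - (nA - UV)² + n(n-1)V²(V² - Σv²)`; by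
  Cauchy–Schwarz for the centred vectors, `(nA - UV)² ≤ (nΣu² - U²)(nΣv² - V²)`, so the right-hand
  side is `≥ n (V² - Σv²)((nΣu² - U²) + (n-1)V²) > 0` for `n ≥ 2` — contradicting `(n-1)c² ≤ b²`
  (for `n = 1` the equations force `c = 0`).

## References

* [Obrechkoff1964] N. Obrechkoff, *Sur une généralisation du théorème de Poulain et Hermite pour
  les zéros réels des polynômes réels*, Acta Math. Acad. Sci. Hungar. 12 (1961), 175–184
  (the theorem; paywalled, not read — statement taken from Kim–Lee).
* [KimLee2021] Y.-O. Kim, J. Lee, *A note on the zeros of Jensen polynomials*, arXiv:2105.05386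
  (2021), Theorem 3 and its Corollary (read: pp. 1–2).
* [Obreschkoff1963] N. Obreschkoff, *Verteilung und Berechnung der Nullstellen reeller Polynome*
  (1963) — the Hermite–Poulain theorem (the tree's `PolyaSchur.splits_aeval_derivOp_apply`).
-/

noncomputable section

open Polynomial Finset
open _root_.Complex
open scoped ComplexConjugate

namespace Literature.Analysis.Complex.Obreschkoff

open Literature.Analysis.Complex.PolyaSchur

/-! ### The double sector `S(δ)` and the quadratic operator `(D - b)² + c²` -/

/-- Kim–Lee's double sector `S(δ) = {z ∈ ℂ : |Im z| ≤ δ |z|}` around the real axis.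
[cite: KimLee2021, before Theorem 3] -/
def sector (δ : ℝ) : Set ℂ := {z : ℂ | |z.im| ≤ δ * ‖z‖}

/-- Membership in the sector, unfolded. [cite: KimLee2021, before Theorem 3] -/
theorem mem_sector {δ : ℝ} {z : ℂ} : z ∈ sector δ ↔ |z.im| ≤ δ * ‖z‖ := Iff.rfl

/-- Real numbers lie in every sector `S(δ)`, `δ ≥ 0`. [folklore] -/
theorem ofReal_mem_sector {δ : ℝ} (hδ : 0 ≤ δ) (x : ℝ) : (x : ℂ) ∈ sector δ := by
  rw [mem_sector, ofReal_im, abs_zero]; positivity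

/-- The quadratic differential operator `((D - b)² + c²) Q = Q'' - 2b Q' + (b² + c²) Q`.
[folklore] -/
def quadOp (b c : ℝ) (Q : ℝ[X]) : ℝ[X] :=
  derivative (derivative Q) - C (2 * b) * derivative Q + C (b ^ 2 + c ^ 2) * Q

/-- `derivOp` is the derivative. [folklore] -/
@[simp] theorem derivOp_apply (Q : ℝ[X]) : derivOp Q = derivative Q := rfl

/-- `quadOp b c` is `q(D)` for the real quadratic `q = X² - 2bX + (b² + c²) = (X - b)² + c²`.
[folklore] -/
theorem aeval_derivOp_quadratic_apply (b c : ℝ) (Q : ℝ[X]) :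
    aeval derivOp (X ^ 2 - C (2 * b) * X + C (b ^ 2 + c ^ 2)) Q = quadOp b c Q := by
  have h1 : aeval derivOp (X ^ 2 : ℝ[X]) Q = derivative (derivative Q) := by
    simp [sq, Module.End.mul_apply]
  have h2 : aeval derivOp (C (2 * b) * X : ℝ[X]) Q = C (2 * b) * derivative Q := by
    rw [map_mul, Module.End.mul_apply, aeval_X, derivOp_apply, aeval_derivOp_C_apply]
  rw [map_add, map_sub, LinearMap.add_apply, LinearMap.sub_apply, h1, h2, aeval_derivOp_C_apply,
    quadOp]

/-- For `c = 0` the operator factors: `quadOp b 0 Q = (D - b)((D - b) Q)`. [folklore] -/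
theorem quadOp_zero_right (b : ℝ) (Q : ℝ[X]) :
    quadOp b 0 Q = derivative (derivative Q - C b * Q) - C b * (derivative Q - C b * Q) := by
  have h0 : b ^ 2 + (0 : ℝ) ^ 2 = b * b := by ring
  rw [quadOp, h0]
  simp only [derivative_sub, derivative_mul, derivative_C, zero_mul, zero_add, map_mul, map_ofNat]
  ring

/-- `quadOp` commutes with constant factors. [folklore] -/
theorem quadOp_C_mul (b c a : ℝ) (Q : ℝ[X]) : quadOp b c (C a * Q) = C a * quadOp b c Q := by
  simp only [quadOp, derivative_mul, derivative_C, zero_mul, zero_add]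
  ring

/-- `quadOp` does not raise the degree. [folklore] -/
theorem natDegree_quadOp_le (b c : ℝ) (Q : ℝ[X]) : (quadOp b c Q).natDegree ≤ Q.natDegree := by
  rw [← aeval_derivOp_quadratic_apply]
  exact natDegree_aeval_derivOp_apply_le _ _

/-! ### Logarithmic derivatives of a product of linear factors -/

section logDeriv

variable {ι : Type*}

/-- `q_s = ∏_{i ∈ s} (X - r_i)` over `ℂ`. [folklore] -/
theorem eval_prod_X_sub_C (s : Finset ι) (r : ι → ℂ) (z : ℂ) :
    (∏ i ∈ s, (X - C (r i))).eval z = ∏ i ∈ s, (z - r i) := by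
  simp [eval_prod]

/-- First logarithmic derivative: `q'(z) = q(z) Σ 1/(z - r_i)` off the roots. [folklore] -/
theorem eval_derivative_prod_X_sub_C [DecidableEq ι] (s : Finset ι) (r : ι → ℂ) {z : ℂ}
    (hz : ∀ i ∈ s, z ≠ r i) :
    (derivative (∏ i ∈ s, (X - C (r i)))).eval z =
      (∏ i ∈ s, (z - r i)) * ∑ i ∈ s, (z - r i)⁻¹ := by
  induction s using Finset.induction_on with
  | empty => simp
  | insert a s ha ih =>
    have hz' : ∀ i ∈ s, z ≠ r i := fun i hi => hz i (mem_insert_of_mem hi)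
    have hza : z - r a ≠ 0 := sub_ne_zero.2 (hz a (mem_insert_self a s))
    rw [prod_insert ha, derivative_mul]
    simp only [eval_add, eval_mul, eval_sub, eval_X, eval_C, derivative_sub, derivative_X,
      derivative_C, sub_zero, eval_one, ih hz', eval_prod_X_sub_C, prod_insert ha, sum_insert ha]
    field_simp

/-- Second logarithmic derivative: `q''(z) = q(z) ((Σ 1/(z - r_i))² - Σ 1/(z - r_i)²)` off the
roots. [folklore] -/
theorem eval_derivative_derivative_prod_X_sub_C [DecidableEq ι] (s : Finset ι) (r : ι → ℂ) {z : ℂ}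
    (hz : ∀ i ∈ s, z ≠ r i) :
    (derivative (derivative (∏ i ∈ s, (X - C (r i))))).eval z =
      (∏ i ∈ s, (z - r i)) * ((∑ i ∈ s, (z - r i)⁻¹) ^ 2 - ∑ i ∈ s, (z - r i)⁻¹ ^ 2) := by
  induction s using Finset.induction_on with
  | empty => simp
  | insert a s ha ih =>
    have hz' : ∀ i ∈ s, z ≠ r i := fun i hi => hz i (mem_insert_of_mem hi)
    have hza : z - r a ≠ 0 := sub_ne_zero.2 (hz a (mem_insert_self a s))
    have h1 := eval_derivative_prod_X_sub_C s r hz'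
    rw [prod_insert ha, derivative_mul, derivative_add, derivative_mul, derivative_mul]
    simp only [eval_add, eval_mul, eval_sub, eval_X, eval_C, derivative_sub, derivative_X,
      derivative_C, sub_zero, derivative_one, ih hz',
      eval_derivative_prod_X_sub_C s r hz', prod_insert ha, sum_insert ha,
      zero_mul, one_mul, zero_add]
    field_simp
    ring

end logDeriv

/-! ### Real inequalities behind the key lemma -/

section ineq

variable {ι : Type*}

/-- For at least two positive numbers, `Σ pᵢ² < (Σ pᵢ)²`. [folklore] -/
theorem sum_sq_lt_sq_sum_of_pos (T : Finset ι) (p : ι → ℝ) (hp : ∀ x ∈ T, 0 < p x)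
    (hT : 2 ≤ #T) : ∑ x ∈ T, p x ^ 2 < (∑ x ∈ T, p x) ^ 2 := by
  classical
  have hne : T.Nonempty := card_pos.1 (by omega)
  -- `Σ_x p_x (Σ_{y ≠ x} p_y) = (Σ p)² - Σ p²`
  have key : ∑ x ∈ T, p x * ∑ y ∈ T.erase x, p y = (∑ x ∈ T, p x) ^ 2 - ∑ x ∈ T, p x ^ 2 := by
    rw [sum_congr rfl fun x hx => show p x * ∑ y ∈ T.erase x, p y =
        p x * (∑ y ∈ T, p y) - p x ^ 2 by rw [sum_erase_eq_sub hx]; ring,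
      sum_sub_distrib, ← sum_mul, sq]
  have hpos : 0 < ∑ x ∈ T, p x * ∑ y ∈ T.erase x, p y := by
    refine sum_pos (fun x hx => mul_pos (hp x hx) (sum_pos (fun y hy => hp y (mem_of_mem_erase hy))
      ?_)) hne
    rw [← card_pos, card_erase_of_mem hx]; omega
  linarith

/-- Same-sign version: if `vᵢ = y pᵢ` with `y ≠ 0`, `pᵢ > 0` and at least two indices, then
`Σ vᵢ² < (Σ vᵢ)²`. [folklore] -/
theorem sum_sq_lt_sq_sum_of_eq_mul (T : Finset ι) (v p : ι → ℝ) (y : ℝ) (hy : y ≠ 0)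
    (hp : ∀ x ∈ T, 0 < p x) (hv : ∀ x ∈ T, v x = y * p x) (hT : 2 ≤ #T) :
    ∑ x ∈ T, v x ^ 2 < (∑ x ∈ T, v x) ^ 2 := by
  have h1 : ∑ x ∈ T, v x ^ 2 = y ^ 2 * ∑ x ∈ T, p x ^ 2 := by
    rw [mul_sum]; exact sum_congr rfl fun x hx => by rw [hv x hx]; ring
  have h2 : ∑ x ∈ T, v x = y * ∑ x ∈ T, p x := by
    rw [mul_sum]; exact sum_congr rfl fun x hx => hv x hx
  rw [h1, h2, mul_pow]
  exact mul_lt_mul_of_pos_left (sum_sq_lt_sq_sum_of_pos T p hp hT) (by positivity)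

/-- **Cauchy–Schwarz for centred vectors**: with `n = #T`, `U = Σu`, `V = Σv`, `A = Σuv`,
`(nA - UV)² ≤ (nΣu² - U²)(nΣv² - V²)`. [folklore] -/
theorem centred_cauchy_schwarz (T : Finset ι) (u v : ι → ℝ) :
    ((#T : ℝ) * ∑ x ∈ T, u x * v x - (∑ x ∈ T, u x) * ∑ x ∈ T, v x) ^ 2 ≤
      ((#T : ℝ) * ∑ x ∈ T, u x ^ 2 - (∑ x ∈ T, u x) ^ 2) *
        ((#T : ℝ) * ∑ x ∈ T, v x ^ 2 - (∑ x ∈ T, v x) ^ 2) := by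
  rcases Nat.eq_zero_or_pos #T with h0 | hpos
  · rw [card_eq_zero.1 h0]; simp
  set n : ℝ := ((#T : ℕ) : ℝ) with hn
  have hn0 : n ≠ 0 := by rw [hn]; exact_mod_cast hpos.ne'
  set U := ∑ x ∈ T, u x
  set V := ∑ x ∈ T, v x
  have hcs := sum_mul_sq_le_sq_mul_sq T (fun x => u x - U / n) (fun x => v x - V / n)
  have e1 : ∑ x ∈ T, (u x - U / n) * (v x - V / n) = ∑ x ∈ T, u x * v x - U * V / n := by
    have : ∀ x, (u x - U / n) * (v x - V / n) =
        u x * v x - V / n * u x - U / n * v x + U * V / n ^ 2 := fun x => by ring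
    simp only [this, sum_add_distrib, sum_sub_distrib, ← mul_sum, sum_const, nsmul_eq_mul, ← hn]
    field_simp
    ring
  have e2 : ∀ w : ι → ℝ, ∑ x ∈ T, (w x - (∑ x ∈ T, w x) / n) ^ 2 =
      ∑ x ∈ T, w x ^ 2 - (∑ x ∈ T, w x) ^ 2 / n := by
    intro w
    have : ∀ x, (w x - (∑ x ∈ T, w x) / n) ^ 2 =
        w x ^ 2 - 2 * ((∑ x ∈ T, w x) / n) * w x + ((∑ x ∈ T, w x) / n) ^ 2 := fun x => by ring
    simp only [this, sum_add_distrib, sum_sub_distrib, ← mul_sum, sum_const, nsmul_eq_mul, ← hn]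
    field_simp
    ring
  rw [e1, e2 u, e2 v] at hcs
  have key : (n * ∑ x ∈ T, u x * v x - U * V) ^ 2 =
      n ^ 2 * (∑ x ∈ T, u x * v x - U * V / n) ^ 2 := by
    field_simp
  have key2 : (n * ∑ x ∈ T, u x ^ 2 - U ^ 2) * (n * ∑ x ∈ T, v x ^ 2 - V ^ 2) =
      n ^ 2 * ((∑ x ∈ T, u x ^ 2 - U ^ 2 / n) * (∑ x ∈ T, v x ^ 2 - V ^ 2 / n)) := by
    field_simp
  rw [key, key2]
  exact mul_le_mul_of_nonneg_left hcs (by positivity)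

/-- **The arithmetic core of the key lemma.** The two real equations coming from a non-real zero
(`A + bV = UV` and `U² - V² - Σu² + Σv² - 2bU + b² + c² = 0`), the centred Cauchy–Schwarz
inequality, `Σv² < V²` and `n ≥ 2` contradict `(n - 1) c² ≤ b²`. [folklore] -/
theorem key_ineq_false {n U V A Su Sv b c : ℝ} (hn : 2 ≤ n) (hE1 : A + b * V = U * V)
    (hE2 : U ^ 2 - V ^ 2 - Su + Sv - 2 * b * U + b ^ 2 + c ^ 2 = 0)
    (hCS : (n * A - U * V) ^ 2 ≤ (n * Su - U ^ 2) * (n * Sv - V ^ 2)) (hSu : U ^ 2 ≤ n * Su)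
    (hSv0 : 0 ≤ Sv) (hSv : Sv < V ^ 2) (hbc : (n - 1) * c ^ 2 ≤ b ^ 2) : False := by
  have key : n * V ^ 2 * ((n - 1) * c ^ 2 - b ^ 2) =
      (n - 1) * V ^ 2 * (n * Su - U ^ 2) - (n * A - U * V) ^ 2 +
        n * (n - 1) * V ^ 2 * (V ^ 2 - Sv) := by
    have hA : A = U * V - b * V := by linarith
    have hc2 : c ^ 2 = Su - (U - b) ^ 2 + V ^ 2 - Sv := by linarith
    rw [hA, hc2]; ring
  have h4 : n * (V ^ 2 - Sv) * ((n * Su - U ^ 2) + (n - 1) * V ^ 2) ≤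
      (n - 1) * V ^ 2 * (n * Su - U ^ 2) - (n * A - U * V) ^ 2 +
        n * (n - 1) * V ^ 2 * (V ^ 2 - Sv) := by
    have : (n - 1) * V ^ 2 * (n * Su - U ^ 2) - (n * A - U * V) ^ 2 +
        n * (n - 1) * V ^ 2 * (V ^ 2 - Sv) - n * (V ^ 2 - Sv) * ((n * Su - U ^ 2) + (n - 1) * V ^ 2)
        = (n * Su - U ^ 2) * (n * Sv - V ^ 2) - (n * A - U * V) ^ 2 := by ring
    linarith
  have hV2 : 0 < V ^ 2 := by linarith
  have h5 : 0 < n * (V ^ 2 - Sv) * ((n * Su - U ^ 2) + (n - 1) * V ^ 2) := by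
    have h51 : 0 < V ^ 2 - Sv := by linarith
    have h52 : 0 < (n - 1) * V ^ 2 := mul_pos (by linarith) hV2
    have h53 : 0 < (n * Su - U ^ 2) + (n - 1) * V ^ 2 := by linarith
    have h54 : (0 : ℝ) < n := by linarith
    positivity
  have h6 : n * V ^ 2 * ((n - 1) * c ^ 2 - b ^ 2) ≤ 0 :=
    mul_nonpos_of_nonneg_of_nonpos (mul_nonneg (by linarith) hV2.le) (by linarith)
  linarith

end ineq

/-! ### The key lemma: `(D - b)² + c²` preserves real-rootedness when `(n - 1)c² ≤ b²` -/

section key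

variable {ι : Type*} [Fintype ι] [DecidableEq ι]

/-- **Root equations.** If `z ∉ ℝ` is a zero of `q'' - 2b q' + (b² + c²) q` for
`q = ∏ᵢ (X - rᵢ)` with real `rᵢ`, then, writing `1/(z - rᵢ) = uᵢ - i vᵢ`, `U = Σuᵢ`, `V = Σvᵢ`,
`A = Σuᵢvᵢ`: `A + bV = UV` and `U² - V² - Σuᵢ² + Σvᵢ² - 2bU + b² + c² = 0`. [folklore] -/
theorem root_eqs_of_eval_quad_eq_zero (r : ι → ℝ) (b c : ℝ) {z : ℂ} (hz : z.im ≠ 0)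
    (u v : ι → ℝ) (hu : ∀ i, ((z - r i)⁻¹).re = u i) (hv : ∀ i, ((z - r i)⁻¹).im = -v i)
    (h : (derivative (derivative (∏ i, (X - C ((r i : ℝ) : ℂ)))) -
        C (2 * (b : ℂ)) * derivative (∏ i, (X - C ((r i : ℝ) : ℂ))) +
        C ((b : ℂ) ^ 2 + (c : ℂ) ^ 2) * ∏ i, (X - C ((r i : ℝ) : ℂ))).eval z = 0) :
    (∑ i, u i * v i + b * ∑ i, v i = (∑ i, u i) * ∑ i, v i) ∧
      ((∑ i, u i) ^ 2 - (∑ i, v i) ^ 2 - ∑ i, u i ^ 2 + ∑ i, v i ^ 2 -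
          2 * b * ∑ i, u i + b ^ 2 + c ^ 2 = 0) := by
  have hzr : ∀ i ∈ (univ : Finset ι), z ≠ ((r i : ℝ) : ℂ) := fun i _ hi =>
    hz (by rw [hi, ofReal_im])
  set w : ι → ℂ := fun i => (z - r i)⁻¹ with hw
  set F : ℂ := ∑ i, w i with hF
  set P₂ : ℂ := ∑ i, w i ^ 2 with hP₂
  have hq : (∏ i, (X - C ((r i : ℝ) : ℂ))).eval z ≠ 0 := by
    rw [eval_prod_X_sub_C]
    exact prod_ne_zero_iff.2 fun i hi => sub_ne_zero.2 (hzr i hi)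
  -- the equation `F² - P₂ - 2bF + b² + c² = 0`
  have hE : F * F - P₂ - 2 * (b : ℂ) * F + ((b : ℂ) * b + (c : ℂ) * c) = 0 := by
    have h1 : (derivative (derivative (∏ i, (X - C ((r i : ℝ) : ℂ)))) -
        C (2 * (b : ℂ)) * derivative (∏ i, (X - C ((r i : ℝ) : ℂ))) +
        C ((b : ℂ) ^ 2 + (c : ℂ) ^ 2) * ∏ i, (X - C ((r i : ℝ) : ℂ))).eval z =
        (∏ i, (X - C ((r i : ℝ) : ℂ))).eval z *
          (F * F - P₂ - 2 * (b : ℂ) * F + ((b : ℂ) * b + (c : ℂ) * c)) := by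
      rw [eval_add, eval_sub, eval_mul, eval_mul, eval_C, eval_C,
        eval_derivative_derivative_prod_X_sub_C _ _ hzr, eval_derivative_prod_X_sub_C _ _ hzr,
        eval_prod_X_sub_C]
      ring
    rw [h1] at h
    exact (mul_eq_zero.1 h).resolve_left hq
  -- real and imaginary parts of `F` and `P₂`
  have hFre : F.re = ∑ i, u i := by
    rw [hF, re_sum]; exact sum_congr rfl fun i _ => hu i
  have hFim : F.im = -∑ i, v i := by
    rw [hF, im_sum, ← sum_neg_distrib]; exact sum_congr rfl fun i _ => hv i
  have hP₂re : P₂.re = ∑ i, u i ^ 2 - ∑ i, v i ^ 2 := by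
    rw [hP₂, re_sum, ← sum_sub_distrib]
    exact sum_congr rfl fun i _ => by rw [sq, mul_re, hu, hv]; ring
  have hP₂im : P₂.im = -(2 * ∑ i, u i * v i) := by
    rw [hP₂, im_sum, mul_sum, ← sum_neg_distrib]
    exact sum_congr rfl fun i _ => by rw [sq, mul_im, hu, hv]; ring
  have hre := congrArg Complex.re hE
  have him := congrArg Complex.im hE
  simp only [sub_re, add_re, mul_re, sub_im, add_im, mul_im, ofReal_re, ofReal_im, zero_re,
    zero_im, re_ofNat, im_ofNat, mul_zero, sub_zero, zero_mul, add_zero, hFre, hFim, hP₂re,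
    hP₂im] at hre him
  constructor
  · linear_combination him / 2
  · linear_combination hre

end key

/-- Bridge `ℝ[X] → ℂ[X]`: a split real polynomial is `lc · ∏ (X - r)` over its roots (indexed by
the multiset of roots as a type). [folklore] -/
theorem map_eq_C_mul_prod_roots {Q : ℝ[X]} (hQ : Q.Splits) :
    Q.map (algebraMap ℝ ℂ) =
      C ((Q.leadingCoeff : ℝ) : ℂ) * ∏ x : Q.roots, (X - C (((x : ℝ) : ℝ) : ℂ)) := by
  have hm : ((univ : Finset Q.roots).val.map fun x : Q.roots => (X - C (((x : ℝ)) : ℂ) : ℂ[X])) =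
      Q.roots.map fun a => X - C ((a : ℝ) : ℂ) :=
    Multiset.map_univ Q.roots (fun a : ℝ => (X - C ((a : ℝ) : ℂ) : ℂ[X]))
  rw [Finset.prod_eq_multiset_prod, hm]
  conv_lhs => rw [hQ.eq_prod_roots]
  rw [Polynomial.map_mul, map_C, Polynomial.map_multiset_prod, Multiset.map_map]
  congr 1
  congr 1
  refine Multiset.map_congr rfl fun a _ => ?_
  simp [Polynomial.map_sub]

/-- **Key lemma.** If the real polynomial `Q` has only real zeros and `(deg Q - 1) c² ≤ b²`, then
`((D - b)² + c²) Q = Q'' - 2b Q' + (b² + c²) Q` has only real zeros. (The quadratic-factor step of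
Obreschkoff's theorem; sharp for `Q = Xⁿ`.) [cite: KimLee2021, Theorem 3] -/
theorem splits_quadOp {Q : ℝ[X]} (hQ : Q.Splits) {b c : ℝ}
    (hbc : ((Q.natDegree : ℝ) - 1) * c ^ 2 ≤ b ^ 2) : (quadOp b c Q).Splits := by
  classical
  by_cases hQ0 : Q = 0
  · rw [hQ0]; simp [quadOp]
  by_cases hc : c = 0
  · subst hc
    rw [quadOp_zero_right]
    exact splits_derivative_sub_C_mul (splits_derivative_sub_C_mul hQ b) b
  refine splits_of_forall_aeval_eq_zero_im_eq_zero fun z hz => ?_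
  by_contra him
  -- data over the roots
  set r : Q.roots → ℝ := fun x => (x : ℝ) with hr
  set u : Q.roots → ℝ := fun x => ((z - r x)⁻¹).re with hu
  set v : Q.roots → ℝ := fun x => -((z - r x)⁻¹).im with hv
  have hlc : ((Q.leadingCoeff : ℝ) : ℂ) ≠ 0 := by
    rw [Ne, ofReal_eq_zero, leadingCoeff_eq_zero]; exact hQ0
  -- the complex form of the equation
  have heval : (derivative (derivative (∏ i, (X - C ((r i : ℝ) : ℂ)))) -
      C (2 * (b : ℂ)) * derivative (∏ i, (X - C ((r i : ℝ) : ℂ))) +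
      C ((b : ℂ) ^ 2 + (c : ℂ) ^ 2) * ∏ i, (X - C ((r i : ℝ) : ℂ))).eval z = 0 := by
    have h1 : (quadOp b c Q).map (algebraMap ℝ ℂ) = C ((Q.leadingCoeff : ℝ) : ℂ) *
        (derivative (derivative (∏ i, (X - C ((r i : ℝ) : ℂ)))) -
          C (2 * (b : ℂ)) * derivative (∏ i, (X - C ((r i : ℝ) : ℂ))) +
          C ((b : ℂ) ^ 2 + (c : ℂ) ^ 2) * ∏ i, (X - C ((r i : ℝ) : ℂ))) := by
      rw [quadOp, Polynomial.map_add, Polynomial.map_sub, Polynomial.map_mul, Polynomial.map_mul,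
        map_C, map_C, ← derivative_map, ← derivative_map, map_eq_C_mul_prod_roots hQ,
        derivative_C_mul, derivative_C_mul]
      simp only [coe_algebraMap, ofReal_mul, ofReal_add, ofReal_pow, ofReal_ofNat]
      ring
    have h2 := hz
    rw [← eval_map_algebraMap, h1, eval_mul, eval_C, mul_eq_zero] at h2
    exact h2.resolve_left hlc
  obtain ⟨hE1, hE2⟩ := root_eqs_of_eval_quad_eq_zero r b c him u v (fun _ => rfl)
    (fun _ => by rw [hv, neg_neg]) heval
  -- sizes and signs
  have hn : Fintype.card Q.roots = Q.natDegree := by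
    rw [Multiset.card_coe, hQ.natDegree_eq_card_roots]
  have hp : ∀ x, 0 < (normSq (z - r x))⁻¹ := fun x =>
    inv_pos.2 (normSq_pos.2 (sub_ne_zero.2 fun h => him (by rw [h, ofReal_im])))
  have hvp : ∀ x, v x = z.im * (normSq (z - r x))⁻¹ := fun x => by
    rw [hv]; simp only [inv_im, sub_im, ofReal_im, sub_zero, div_eq_mul_inv]; ring
  rcases Nat.lt_or_ge (Fintype.card Q.roots) 2 with hlt | hge
  · -- at most one root: the equations force `c = 0`
    apply hc
    rcases Nat.lt_or_ge (Fintype.card Q.roots) 1 with h0 | h1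
    · haveI : IsEmpty Q.roots := Fintype.card_eq_zero_iff.1 (by omega)
      simp only [univ_eq_empty, sum_empty, mul_zero, sub_zero, zero_pow two_ne_zero, add_zero,
        zero_add] at hE2
      have : c ^ 2 = 0 := by nlinarith [sq_nonneg b, sq_nonneg c]
      exact pow_eq_zero_iff two_ne_zero |>.1 this
    · have hcard : Fintype.card Q.roots = 1 := by omega
      obtain ⟨x₀, hx₀⟩ := Fintype.card_eq_one_iff.1 hcard
      have huniv : (univ : Finset Q.roots) = {x₀} := by
        ext y; simp [hx₀ y]
      rw [huniv] at hE1 hE2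
      simp only [sum_singleton] at hE1 hE2
      have hv0 : v x₀ ≠ 0 := by rw [hvp]; exact mul_ne_zero him (hp x₀).ne'
      have hb : b = 0 := by
        have : b * v x₀ = 0 := by linarith
        exact (mul_eq_zero.1 this).resolve_right hv0
      subst hb
      have : c ^ 2 = 0 := by nlinarith [hE2]
      exact pow_eq_zero_iff two_ne_zero |>.1 this
  · -- at least two roots: the inequality
    have hnR : (2 : ℝ) ≤ (Fintype.card Q.roots : ℝ) := by exact_mod_cast hge
    have hcardR : ((#(univ : Finset Q.roots) : ℕ) : ℝ) = (Fintype.card Q.roots : ℝ) := by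
      rw [Finset.card_univ]
    have hCS := centred_cauchy_schwarz (univ : Finset Q.roots) u v
    have hSu : (∑ x, u x) ^ 2 ≤ ((#(univ : Finset Q.roots) : ℕ) : ℝ) * ∑ x, u x ^ 2 :=
      sq_sum_le_card_mul_sum_sq
    have hSv := sum_sq_lt_sq_sum_of_eq_mul (univ : Finset Q.roots) v
      (fun x => (normSq (z - r x))⁻¹) z.im him (fun x _ => hp x) (fun x _ => hvp x)
      (by rwa [Finset.card_univ])
    rw [hcardR] at hCS hSu
    have hbc' : ((Fintype.card Q.roots : ℝ) - 1) * c ^ 2 ≤ b ^ 2 := by rw [hn]; exact hbc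
    exact key_ineq_false hnR hE1 hE2 hCS hSu (sum_nonneg fun x _ => sq_nonneg (v x)) hSv hbc'


/-! ### Obreschkoff's theorem -/

/-- Mathlib's real quadratic `X² - 2 Re β · X + |β|²` (with roots `β, β̄`;
`Polynomial.quadratic_dvd_of_aeval_eq_zero_im_ne_zero`) has degree `2`. [folklore] -/
theorem natDegree_realQuadratic (β : ℂ) :
    (X ^ 2 - C (2 * β.re) * X + C (‖β‖ ^ 2) : ℝ[X]).natDegree = 2 := by
  have e : (X ^ 2 - C (2 * β.re) * X + C (‖β‖ ^ 2) : ℝ[X]) =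
      C 1 * X ^ 2 + C (-(2 * β.re)) * X + C (‖β‖ ^ 2) := by
    simp only [map_one, one_mul, map_neg, neg_mul, sub_eq_add_neg]
  rw [e, natDegree_quadratic one_ne_zero]

/-- Mathlib's real quadratic `X² - 2 Re β · X + |β|²` acts as `quadOp (Re β) (Im β)`. [folklore] -/
theorem aeval_derivOp_realQuadratic_apply (β : ℂ) (Q : ℝ[X]) :
    aeval derivOp (X ^ 2 - C (2 * β.re) * X + C (‖β‖ ^ 2) : ℝ[X]) Q = quadOp β.re β.im Q := by
  rw [← aeval_derivOp_quadratic_apply, Complex.sq_norm, normSq_apply]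
  congr 3
  ring

/-- The sector condition on a non-real root `β = b + ic ∈ S(δ)` together with `m δ² ≤ 1` gives the
hypothesis `(m - 1) c² ≤ b²` of the key lemma. [folklore] -/
theorem key_hyp_of_mem_sector {δ : ℝ} {m : ℕ} (hmδ : (m : ℝ) * δ ^ 2 ≤ 1) {β : ℂ}
    (hβ : β ∈ sector δ) : ((m : ℝ) - 1) * β.im ^ 2 ≤ β.re ^ 2 := by
  rw [mem_sector] at hβ
  have h0 : 0 ≤ δ * ‖β‖ := (abs_nonneg _).trans hβ
  have h1 : β.im ^ 2 ≤ δ ^ 2 * (β.re ^ 2 + β.im ^ 2) := by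
    have := pow_le_pow_left₀ (abs_nonneg _) hβ 2
    rw [sq_abs, mul_pow, Complex.sq_norm, normSq_apply] at this
    nlinarith [this]
  have h2 : (m : ℝ) * β.im ^ 2 ≤ β.re ^ 2 + β.im ^ 2 := by
    have hm0 : (0 : ℝ) ≤ m := by positivity
    calc (m : ℝ) * β.im ^ 2 ≤ (m : ℝ) * (δ ^ 2 * (β.re ^ 2 + β.im ^ 2)) :=
          mul_le_mul_of_nonneg_left h1 hm0
      _ = ((m : ℝ) * δ ^ 2) * (β.re ^ 2 + β.im ^ 2) := by ring
      _ ≤ 1 * (β.re ^ 2 + β.im ^ 2) := mul_le_mul_of_nonneg_right hmδ (by positivity)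
      _ = β.re ^ 2 + β.im ^ 2 := one_mul _
  linarith

/-- **Obreschkoff's theorem** (Kim–Lee 2021, Thm. 3; Obrechkoff 1961). If all complex zeros of the
real polynomial `P` lie in the double sector `S(δ) = {|Im z| ≤ δ|z|}`, `Q` is a real polynomial with
only real zeros and `deg Q ≤ m` with `m δ² ≤ 1` (i.e. `deg Q ≤ δ⁻²`), then `P(D) Q` has only real
zeros. [cite: KimLee2021, Theorem 3] [cite: Obrechkoff1964, Theorem] -/
theorem splits_aeval_derivOp_of_roots_mem_sector {δ : ℝ} {m : ℕ} (hmδ : (m : ℝ) * δ ^ 2 ≤ 1) :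
    ∀ (P Q : ℝ[X]), (∀ z : ℂ, aeval z P = 0 → z ∈ sector δ) → Q.Splits → Q.natDegree ≤ m →
      (aeval derivOp P Q).Splits := by
  intro P
  induction h : P.natDegree using Nat.strong_induction_on generalizing P with
  | _ N ih =>
  intro Q hP hQ hQm
  by_cases hP0 : P = 0
  · rw [hP0, map_zero, LinearMap.zero_apply]; exact Splits.zero
  by_cases hN : P.natDegree = 0
  · obtain ⟨a, rfl⟩ : ∃ a, P = C a := ⟨_, eq_C_of_natDegree_eq_zero hN⟩
    rw [aeval_derivOp_C_apply]; exact hQ.C_mul a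
  -- a complex root `β` of `P`
  obtain ⟨β, hβ⟩ : ∃ β : ℂ, aeval β P = 0 := by
    obtain ⟨β, hβ⟩ := Complex.exists_root (f := P.map (algebraMap ℝ ℂ))
      (by rw [degree_map]; exact natDegree_pos_iff_degree_pos.1 (Nat.pos_of_ne_zero hN))
    exact ⟨β, by rwa [IsRoot.def, eval_map_algebraMap] at hβ⟩
  by_cases hβim : β.im = 0
  · -- a real root `a`: `P = (X - a) P₁`, Hermite–Poulain step
    set a : ℝ := β.re with ha
    have hβa : β = (a : ℂ) := Complex.ext (by simp [ha]) (by simp [hβim])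
    have hroot : IsRoot P a := by
      rw [hβa, ← coe_algebraMap, aeval_algebraMap_apply_eq_algebraMap_eval, map_eq_zero_iff _
        (algebraMap ℝ ℂ).injective] at hβ
      exact hβ
    have hfac : (X - C a) * (P /ₘ (X - C a)) = P := mul_divByMonic_eq_iff_isRoot.2 hroot
    set P₁ := P /ₘ (X - C a) with hP₁
    have hP₁0 : P₁ ≠ 0 := fun h0 => hP0 (by rw [← hfac, h0, mul_zero])
    have hdeg : P₁.natDegree < N := by
      have := congrArg natDegree hfac
      rw [natDegree_mul (X_sub_C_ne_zero a) hP₁0, natDegree_X_sub_C, h] at this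
      omega
    have hP₁roots : ∀ z : ℂ, aeval z P₁ = 0 → z ∈ sector δ := fun z hz =>
      hP z (by rw [← hfac, map_mul, hz, mul_zero])
    have ih1 := ih P₁.natDegree hdeg P₁ rfl Q hP₁roots hQ hQm
    rw [← hfac, map_mul, Module.End.mul_apply, aeval_derivOp_X_sub_C_apply]
    exact splits_derivative_sub_C_mul ih1 a
  · -- a non-real root: quadratic factor (Mathlib's `quadratic_dvd_of_aeval_eq_zero_im_ne_zero`),
    -- then the key lemma
    obtain ⟨P₂, hfac⟩ := P.quadratic_dvd_of_aeval_eq_zero_im_ne_zero hβ hβim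
    have hP₂0 : P₂ ≠ 0 := fun h0 => hP0 (by rw [hfac, h0, mul_zero])
    have hq0 : (X ^ 2 - C (2 * β.re) * X + C (‖β‖ ^ 2) : ℝ[X]) ≠ 0 := fun h0 => by
      have := congrArg natDegree h0
      rw [natDegree_realQuadratic, natDegree_zero] at this
      exact absurd this (by norm_num)
    have hdeg : P₂.natDegree < N := by
      have := congrArg natDegree hfac
      rw [natDegree_mul hq0 hP₂0, natDegree_realQuadratic, h] at this
      omega
    have hP₂roots : ∀ z : ℂ, aeval z P₂ = 0 → z ∈ sector δ := fun z hz =>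
      hP z (by rw [hfac, map_mul, hz, mul_zero])
    have ih2 := ih P₂.natDegree hdeg P₂ rfl Q hP₂roots hQ hQm
    rw [hfac, map_mul, Module.End.mul_apply, aeval_derivOp_realQuadratic_apply]
    refine splits_quadOp ih2 ?_
    have hS : ((aeval derivOp P₂ Q).natDegree : ℝ) ≤ m := by
      exact_mod_cast (natDegree_aeval_derivOp_apply_le _ _).trans hQm
    have hkey := key_hyp_of_mem_sector hmδ (hP β hβ)
    have : (((aeval derivOp P₂ Q).natDegree : ℝ) - 1) * β.im ^ 2 ≤ ((m : ℝ) - 1) * β.im ^ 2 :=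
      mul_le_mul_of_nonneg_right (by linarith) (sq_nonneg _)
    linarith

/-- `P(D) Q = Σ_{k ≤ deg P} (P⁽ᵏ⁾(0)/k!) Q⁽ᵏ⁾ = Σ_k [X^k]P · Q⁽ᵏ⁾` — the printed form of the operator in
Kim–Lee's Theorem 3. [cite: KimLee2021, Theorem 3] -/
theorem aeval_derivOp_eq_sum (P Q : ℝ[X]) :
    aeval derivOp P Q = ∑ k ∈ range (P.natDegree + 1), P.coeff k • derivative^[k] Q := by
  conv_lhs => rw [P.as_sum_range_C_mul_X_pow]
  rw [map_sum, LinearMap.sum_apply]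
  exact sum_congr rfl fun k _ => by rw [C_mul_X_pow_eq_monomial, aeval_derivOp_monomial_apply]

/-- **Corollary (Kim–Lee 2021): Jensen polynomials of a real polynomial with zeros in `S(δ)` are
hyperbolic up to degree `δ⁻²`.** If all complex zeros of `P ∈ ℝ[X]` lie in `S(δ)` and `d δ² ≤ 1`,
then `J^{d,0}` of the Taylor sequence `(P⁽ᵏ⁾(0))_k` of `P` — i.e. `J(P; d) = Σ_k (d choose k)
P⁽ᵏ⁾(0) X^k` — has only real zeros (`Q = X^d` in the theorem and `J(P;d) = X^d (P(D)X^d)(1/X)`).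
[cite: KimLee2021, Corollary to Theorem 3] -/
theorem splits_jensenPoly_taylorSeq_of_roots_mem_sector {P : ℝ[X]} {δ : ℝ}
    (hP : ∀ z : ℂ, aeval z P = 0 → z ∈ sector δ) {d : ℕ} (hd : (d : ℝ) * δ ^ 2 ≤ 1) :
    (Literature.NumberTheory.LFunctions.jensenPoly (taylorSeq P) d 0).Splits := by
  rw [jensenPoly_taylorSeq_eq_reflect]
  exact splits_reflect (splits_aeval_derivOp_of_roots_mem_sector hd P (X ^ d) hP (Splits.X_pow d)
    (natDegree_X_pow_le d)) ((natDegree_aeval_derivOp_apply_le _ _).trans (natDegree_X_pow_le d))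

end Literature.Analysis.Complex.Obreschkoff
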